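/-
Copyright (c) 2026 the pub-hodgecm-mathlib formalisation cell (harness21).  Prover seat hodgecm-mathlib-K2E4-p04 (g2), Track B «K2-LIT» ∕ h413, base file #4
`sig_K2E4ExplicitNonsplitConstantPhase` of the line `K2_E4_SingularTransferKappaSign`: socket #4 CLOSED MODULO #5 ALONE, now that #7R is ★ (p855717).  2026-09-03.
-/
import Summits.HodgeConjecture.HodgeConjecture.Theorems.K2E4ExplicitNonsplitConstantPhaseOfGermSocketsR  -- ★ p854945 (this base, g0): `explicitNonsplitConstantPhase_of_germConstantsR : ‹#5› → ‹#7R› → ‹#4›` (brings the socket frame's ★ imports)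
import Summits.HodgeConjecture.HodgeConjecture.Theorems.K2E3GermConstantRegularHR                     -- ★ p855717 (K2E4-p07 (g2)): `germConstantRegularHR` = socket #7R `sig_K2E3GermConstantRegularHR` BY NAME
import HarnessLib

/-!
# K2 · E4 — `Theorems/K2E4ExplicitNonsplitConstantPhaseOfStableSheets.lean`: socket #4 `sig_K2E4ExplicitNonsplitConstantPhase` from socket #5 `sig_K2E3GermConstantStableSheets` ALONE
# (Rogawski 1990, Prop. 8.2.1 (a) p. 118 ⟸ Prop. 8.1.3 p. 116, (8.1.1)–(8.1.2) p. 117; §4.9 p. 55)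

HCML Track B «K2-LIT», cell `pub/hodgecm-mathlib`, crux H413 = `stmt-HodgeConjecture-24833` (`--supports … --as helper`), seat `hodgecm-mathlib-K2E4-p04` (g2), base file #4
`sig_K2E4ExplicitNonsplitConstantPhase` (L) of `Cruxes/H413/Lines/K2_E4_SingularTransferKappaSignSigsFinSingularTransferExplicit.lean` (U4, ED. 2 :259–321, bytes frozen).
COMPOSITION (no new mathematics): ★ p854945 `explicitNonsplitConstantPhase_of_germConstantsR : ‹#5› → ‹#7R› → ‹#4›` (g0 of this base: #5, #7R ⇒ #3 by ℂ-linearity, K2E4-p03 ★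
`explicitNonsplitSingularTransfer_of_germConstantsR`; #3 ⇒ #4 by positivity + real structure, ★ p854906) with its SECOND hypothesis discharged BY NAME by ★ p855717
`K2E3GermConstantRegularHR.germConstantRegularHR` (K2E4-p07 (g2): socket #7R `sig_K2E3GermConstantRegularHR` — a smooth `Δ‴_v`-transfer pair charging `γ_{H,v}` at EVERY finite
`v`, paid through ★ DescentWitness → DockSideOnly → LocalPair → NearCentral window (this seat, ★ p855254) → assembly, + ★ split places).  Hence
**`explicitNonsplitConstantPhase_of_germConstantStableSheets : ‹sig_K2E3GermConstantStableSheets› → ‹sig_K2E4ExplicitNonsplitConstantPhase›`**: socket #4 is CLOSED MODULO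
SOCKET #5 ALONE (the germ-comparison kernel, OWNER K2E3; REL in `…Sigs_U3bCentralGerms` ED. 2 over (ii) + (S_loc)), and its BY-NAME payment is the one-liner
`Theorems/K2E4ExplicitNonsplitConstantPhase.lean := explicitNonsplitConstantPhase_of_germConstantStableSheets … ‹#5-thm …›` the minute #5 is ★.  Hypothesis = #5's bytes
(`…SigsFinGermConstants.lean` ED. 5 :119–177) verbatim; conclusion = #4's bytes verbatim; frame = the sockets' frame :36–104 byte for byte.
Print: «(a) Then `Δ_{G/H}(γ₀)Φ^κ(γ₀, f) = f^H(γ₀)`» [Prop. 8.2.1 (a) p. 118]; «Assume that compatible measure on H and H′ are used.» [p. 119]; «`Δ_{G/H}(γ) = τ(γ) D_{G/H}(γ)`» [§4.9 p. 55].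

HONEST LABEL: HC_CM is proved only modulo the 7 printed citations (2 remaining named inputs: hLiu418 = stmt-HodgeConjecture-24832, h413 = stmt-HodgeConjecture-24833) until rung 0
closes; this file is an unconditional implication between frozen socket statements and moves no counter by itself.  No `sorry`, axioms ⊆ the trio, no `def`, no instance, no notation.

## References
* [Rogawski1990] J. D. Rogawski, *Automorphic Representations of Unitary Groups in Three Variables*, Ann. of Math. Stud. 123 (1990): §8.1 Prop. 8.1.3 p. 116, (8.1.1)–(8.1.2),
  Prop. 8.1.4 p. 117; §8.2 Prop. 8.2.1 (a) p. 118; §4.9 p. 55; §4.3 (4.3.1) p. 43.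
-/

set_option autoImplicit false
set_option linter.dupNamespace false

noncomputable section

open MeasureTheory Measure NumberField IsDedekindDomain
open Literature.MeasureTheory.Group Literature.MeasureTheory.RestrictedProduct
open Literature.Topology.RestrictedProduct Literature.Topology.Algebra.RestrictedProduct
open Literature.NumberTheory.Rogawski1990 Literature.NumberTheory.Automorphic
open Literature.AlgebraicGeometry.ShimuraVarieties (unitaryGroup hermForm)
open scoped Matrix MatrixGroups RestrictedProduct

namespace Summit.HodgeConjecture.HodgeConjecture.Cruxes.H413.K2E4ExplicitNonsplitConstantPhaseOfStableSheets

section Frame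

variable (L : Type) [Field L] [NumberField L] [IsCMField L]

variable (H' : Matrix (Fin 3) (Fin 3) L) (Tinf : ArchTransferFactor L H')
    -- σ-algebras of the `G′` side (★ (O10-c5) block), of `H_v`, `G_∞`, `H_∞`, and the Haar data — EXACTLY ★ `SingularEllipticTransfer`'s binders
    [∀ g : (UnitaryGroup.cmDatum L 3 H').Adelic, MeasurableSpace ((UnitaryGroup.cmDatum L 3 H').Adelic ⧸ Subgroup.centralizer ({g} : Set (UnitaryGroup.cmDatum L 3 H').Adelic))]
    [∀ g : (UnitaryGroup.cmDatum L 3 H').Adelic, BorelSpace ((UnitaryGroup.cmDatum L 3 H').Adelic ⧸ Subgroup.centralizer ({g} : Set (UnitaryGroup.cmDatum L 3 H').Adelic))]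
    [∀ γ : UnitaryGroup.arch (↥(maximalRealSubfield L)) L (IsCMField.complexConj L) 3 H',
      MeasurableSpace (UnitaryGroup.arch (↥(maximalRealSubfield L)) L (IsCMField.complexConj L) 3 H' ⧸ Subgroup.centralizer ({γ} : Set (UnitaryGroup.arch (↥(maximalRealSubfield L)) L (IsCMField.complexConj L) 3 H')))]
    [∀ γ : UnitaryGroup.arch (↥(maximalRealSubfield L)) L (IsCMField.complexConj L) 3 H',
      BorelSpace (UnitaryGroup.arch (↥(maximalRealSubfield L)) L (IsCMField.complexConj L) 3 H' ⧸ Subgroup.centralizer ({γ} : Set (UnitaryGroup.arch (↥(maximalRealSubfield L)) L (IsCMField.complexConj L) 3 H')))]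
    [∀ (v : HeightOneSpectrum (𝓞 ↥(maximalRealSubfield L))) (γ : (UnitaryGroup.cmDatum L 3 H').Local v),
      MeasurableSpace ((UnitaryGroup.cmDatum L 3 H').Local v ⧸ Subgroup.centralizer ({γ} : Set ((UnitaryGroup.cmDatum L 3 H').Local v)))]
    [∀ (v : HeightOneSpectrum (𝓞 ↥(maximalRealSubfield L))) (γ : (UnitaryGroup.cmDatum L 3 H').Local v),
      BorelSpace ((UnitaryGroup.cmDatum L 3 H').Local v ⧸ Subgroup.centralizer ({γ} : Set ((UnitaryGroup.cmDatum L 3 H').Local v)))]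
    [∀ v : HeightOneSpectrum (𝓞 ↥(maximalRealSubfield L)), MeasurableSpace ((UnitaryGroup.cmDatum L 3 H').Local v)] [∀ v : HeightOneSpectrum (𝓞 ↥(maximalRealSubfield L)), BorelSpace ((UnitaryGroup.cmDatum L 3 H').Local v)]
    [MeasurableSpace (UnitaryGroup.cmDatum L 3 H').Adelic] [BorelSpace (UnitaryGroup.cmDatum L 3 H').Adelic]
    [MeasurableSpace (UnitaryGroup.arch (↥(maximalRealSubfield L)) L (IsCMField.complexConj L) 3 H')] [BorelSpace (UnitaryGroup.arch (↥(maximalRealSubfield L)) L (IsCMField.complexConj L) 3 H')]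
    [∀ γ : (UnitaryGroup.cmDatum L 3 H').Adelic, MeasurableSpace (↥(Subgroup.centralizer ({γ} : Set (UnitaryGroup.cmDatum L 3 H').Adelic)) ⧸
      ((UnitaryGroup.cmDatum L 3 H').quotientSubgroup ⊓ Subgroup.centralizer ({γ} : Set (UnitaryGroup.cmDatum L 3 H').Adelic)).subgroupOf (Subgroup.centralizer ({γ} : Set (UnitaryGroup.cmDatum L 3 H').Adelic)))]
    [∀ γ : (UnitaryGroup.cmDatum L 3 H').Adelic, BorelSpace (↥(Subgroup.centralizer ({γ} : Set (UnitaryGroup.cmDatum L 3 H').Adelic)) ⧸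
      ((UnitaryGroup.cmDatum L 3 H').quotientSubgroup ⊓ Subgroup.centralizer ({γ} : Set (UnitaryGroup.cmDatum L 3 H').Adelic)).subgroupOf (Subgroup.centralizer ({γ} : Set (UnitaryGroup.cmDatum L 3 H').Adelic)))]
    [hCcl : ∀ γ : (UnitaryGroup.cmDatum L 3 H').Adelic, IsClosed ((Subgroup.centralizer ({γ} : Set (UnitaryGroup.cmDatum L 3 H').Adelic) : Subgroup (UnitaryGroup.cmDatum L 3 H').Adelic) : Set (UnitaryGroup.cmDatum L 3 H').Adelic)]
    [∀ γ : (UnitaryGroup.cmDatum L 3 H').Adelic, (count : Measure ↥(((UnitaryGroup.cmDatum L 3 H').quotientSubgroup ⊓ Subgroup.centralizer ({γ} : Set (UnitaryGroup.cmDatum L 3 H').Adelic)).subgroupOf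
      (Subgroup.centralizer ({γ} : Set (UnitaryGroup.cmDatum L 3 H').Adelic)))).IsHaarMeasure]
    [∀ v : HeightOneSpectrum (𝓞 ↥(maximalRealSubfield L)), MeasurableSpace ((UnitaryGroup.cmDatum L 2 (Matrix.of fun i j : Fin 2 => if i.val + j.val + 1 = 2 then (1 : L) else 0)).Local v ×
        (UnitaryGroup.cmDatum L 1 (Matrix.of fun i j : Fin 1 => if i.val + j.val + 1 = 1 then (1 : L) else 0)).Local v)]
    [∀ v : HeightOneSpectrum (𝓞 ↥(maximalRealSubfield L)), BorelSpace ((UnitaryGroup.cmDatum L 2 (Matrix.of fun i j : Fin 2 => if i.val + j.val + 1 = 2 then (1 : L) else 0)).Local v ×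
        (UnitaryGroup.cmDatum L 1 (Matrix.of fun i j : Fin 1 => if i.val + j.val + 1 = 1 then (1 : L) else 0)).Local v)]
    [∀ (v : HeightOneSpectrum (𝓞 ↥(maximalRealSubfield L))) (a : ((UnitaryGroup.cmDatum L 2 (Matrix.of fun i j : Fin 2 => if i.val + j.val + 1 = 2 then (1 : L) else 0)).Local v ×
        (UnitaryGroup.cmDatum L 1 (Matrix.of fun i j : Fin 1 => if i.val + j.val + 1 = 1 then (1 : L) else 0)).Local v)),
      MeasurableSpace (((UnitaryGroup.cmDatum L 2 (Matrix.of fun i j : Fin 2 => if i.val + j.val + 1 = 2 then (1 : L) else 0)).Local v ×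
        (UnitaryGroup.cmDatum L 1 (Matrix.of fun i j : Fin 1 => if i.val + j.val + 1 = 1 then (1 : L) else 0)).Local v) ⧸ Subgroup.centralizer ({a} : Set ((UnitaryGroup.cmDatum L 2 (Matrix.of fun i j : Fin 2 => if i.val + j.val + 1 = 2 then (1 : L) else 0)).Local v ×
        (UnitaryGroup.cmDatum L 1 (Matrix.of fun i j : Fin 1 => if i.val + j.val + 1 = 1 then (1 : L) else 0)).Local v)))]
    [∀ (v : HeightOneSpectrum (𝓞 ↥(maximalRealSubfield L))) (a : ((UnitaryGroup.cmDatum L 2 (Matrix.of fun i j : Fin 2 => if i.val + j.val + 1 = 2 then (1 : L) else 0)).Local v ×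
        (UnitaryGroup.cmDatum L 1 (Matrix.of fun i j : Fin 1 => if i.val + j.val + 1 = 1 then (1 : L) else 0)).Local v)),
      BorelSpace (((UnitaryGroup.cmDatum L 2 (Matrix.of fun i j : Fin 2 => if i.val + j.val + 1 = 2 then (1 : L) else 0)).Local v ×
        (UnitaryGroup.cmDatum L 1 (Matrix.of fun i j : Fin 1 => if i.val + j.val + 1 = 1 then (1 : L) else 0)).Local v) ⧸ Subgroup.centralizer ({a} : Set ((UnitaryGroup.cmDatum L 2 (Matrix.of fun i j : Fin 2 => if i.val + j.val + 1 = 2 then (1 : L) else 0)).Local v ×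
        (UnitaryGroup.cmDatum L 1 (Matrix.of fun i j : Fin 1 => if i.val + j.val + 1 = 1 then (1 : L) else 0)).Local v)))]
    [MeasurableSpace (UnitaryGroup.arch (↥(maximalRealSubfield L)) L (IsCMField.complexConj L) 3 (Matrix.of fun i j : Fin 3 => if i.val + j.val + 1 = 3 then (1 : L) else 0))] [BorelSpace (UnitaryGroup.arch (↥(maximalRealSubfield L)) L (IsCMField.complexConj L) 3 (Matrix.of fun i j : Fin 3 => if i.val + j.val + 1 = 3 then (1 : L) else 0))]
    [∀ γ : UnitaryGroup.arch (↥(maximalRealSubfield L)) L (IsCMField.complexConj L) 3 (Matrix.of fun i j : Fin 3 => if i.val + j.val + 1 = 3 then (1 : L) else 0),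
      MeasurableSpace (UnitaryGroup.arch (↥(maximalRealSubfield L)) L (IsCMField.complexConj L) 3 (Matrix.of fun i j : Fin 3 => if i.val + j.val + 1 = 3 then (1 : L) else 0) ⧸ Subgroup.centralizer ({γ} : Set (UnitaryGroup.arch (↥(maximalRealSubfield L)) L (IsCMField.complexConj L) 3 (Matrix.of fun i j : Fin 3 => if i.val + j.val + 1 = 3 then (1 : L) else 0))))]
    [∀ γ : UnitaryGroup.arch (↥(maximalRealSubfield L)) L (IsCMField.complexConj L) 3 (Matrix.of fun i j : Fin 3 => if i.val + j.val + 1 = 3 then (1 : L) else 0),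
      BorelSpace (UnitaryGroup.arch (↥(maximalRealSubfield L)) L (IsCMField.complexConj L) 3 (Matrix.of fun i j : Fin 3 => if i.val + j.val + 1 = 3 then (1 : L) else 0) ⧸ Subgroup.centralizer ({γ} : Set (UnitaryGroup.arch (↥(maximalRealSubfield L)) L (IsCMField.complexConj L) 3 (Matrix.of fun i j : Fin 3 => if i.val + j.val + 1 = 3 then (1 : L) else 0))))]
    [MeasurableSpace (UnitaryGroup.arch (↥(maximalRealSubfield L)) L (IsCMField.complexConj L) 2 (Matrix.of fun i j : Fin 2 => if i.val + j.val + 1 = 2 then (1 : L) else 0) ×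
          UnitaryGroup.arch (↥(maximalRealSubfield L)) L (IsCMField.complexConj L) 1 (Matrix.of fun i j : Fin 1 => if i.val + j.val + 1 = 1 then (1 : L) else 0))]
    [BorelSpace (UnitaryGroup.arch (↥(maximalRealSubfield L)) L (IsCMField.complexConj L) 2 (Matrix.of fun i j : Fin 2 => if i.val + j.val + 1 = 2 then (1 : L) else 0) ×
          UnitaryGroup.arch (↥(maximalRealSubfield L)) L (IsCMField.complexConj L) 1 (Matrix.of fun i j : Fin 1 => if i.val + j.val + 1 = 1 then (1 : L) else 0))]
    [∀ a : (UnitaryGroup.arch (↥(maximalRealSubfield L)) L (IsCMField.complexConj L) 2 (Matrix.of fun i j : Fin 2 => if i.val + j.val + 1 = 2 then (1 : L) else 0) ×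
          UnitaryGroup.arch (↥(maximalRealSubfield L)) L (IsCMField.complexConj L) 1 (Matrix.of fun i j : Fin 1 => if i.val + j.val + 1 = 1 then (1 : L) else 0)),
      MeasurableSpace ((UnitaryGroup.arch (↥(maximalRealSubfield L)) L (IsCMField.complexConj L) 2 (Matrix.of fun i j : Fin 2 => if i.val + j.val + 1 = 2 then (1 : L) else 0) ×
          UnitaryGroup.arch (↥(maximalRealSubfield L)) L (IsCMField.complexConj L) 1 (Matrix.of fun i j : Fin 1 => if i.val + j.val + 1 = 1 then (1 : L) else 0)) ⧸ Subgroup.centralizer ({a} : Set (UnitaryGroup.arch (↥(maximalRealSubfield L)) L (IsCMField.complexConj L) 2 (Matrix.of fun i j : Fin 2 => if i.val + j.val + 1 = 2 then (1 : L) else 0) ×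
          UnitaryGroup.arch (↥(maximalRealSubfield L)) L (IsCMField.complexConj L) 1 (Matrix.of fun i j : Fin 1 => if i.val + j.val + 1 = 1 then (1 : L) else 0))))]
    [∀ a : (UnitaryGroup.arch (↥(maximalRealSubfield L)) L (IsCMField.complexConj L) 2 (Matrix.of fun i j : Fin 2 => if i.val + j.val + 1 = 2 then (1 : L) else 0) ×
          UnitaryGroup.arch (↥(maximalRealSubfield L)) L (IsCMField.complexConj L) 1 (Matrix.of fun i j : Fin 1 => if i.val + j.val + 1 = 1 then (1 : L) else 0)),
      BorelSpace ((UnitaryGroup.arch (↥(maximalRealSubfield L)) L (IsCMField.complexConj L) 2 (Matrix.of fun i j : Fin 2 => if i.val + j.val + 1 = 2 then (1 : L) else 0) ×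
          UnitaryGroup.arch (↥(maximalRealSubfield L)) L (IsCMField.complexConj L) 1 (Matrix.of fun i j : Fin 1 => if i.val + j.val + 1 = 1 then (1 : L) else 0)) ⧸ Subgroup.centralizer ({a} : Set (UnitaryGroup.arch (↥(maximalRealSubfield L)) L (IsCMField.complexConj L) 2 (Matrix.of fun i j : Fin 2 => if i.val + j.val + 1 = 2 then (1 : L) else 0) ×
          UnitaryGroup.arch (↥(maximalRealSubfield L)) L (IsCMField.complexConj L) 1 (Matrix.of fun i j : Fin 1 => if i.val + j.val + 1 = 1 then (1 : L) else 0))))]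
    (νH : ∀ v : HeightOneSpectrum (𝓞 ↥(maximalRealSubfield L)), Measure ((UnitaryGroup.cmDatum L 2 (Matrix.of fun i j : Fin 2 => if i.val + j.val + 1 = 2 then (1 : L) else 0)).Local v ×
        (UnitaryGroup.cmDatum L 1 (Matrix.of fun i j : Fin 1 => if i.val + j.val + 1 = 1 then (1 : L) else 0)).Local v))
    (νG : ∀ v : HeightOneSpectrum (𝓞 ↥(maximalRealSubfield L)), Measure ((UnitaryGroup.cmDatum L 3 H').Local v))
    [∀ v, IsFiniteMeasureOnCompacts (νH v)] [∀ v, (νH v).IsMulRightInvariant]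
    [∀ v, (νG v).IsHaarMeasure] [∀ v, (νG v).IsMulRightInvariant]  -- MAIN-b's strength (F2): `νG_v` Haar
    (νGi : Measure (UnitaryGroup.arch (↥(maximalRealSubfield L)) L (IsCMField.complexConj L) 3 H')) (νqi : Measure (UnitaryGroup.arch (↥(maximalRealSubfield L)) L (IsCMField.complexConj L) 3 (Matrix.of fun i j : Fin 3 => if i.val + j.val + 1 = 3 then (1 : L) else 0)))
    (νHi : Measure (UnitaryGroup.arch (↥(maximalRealSubfield L)) L (IsCMField.complexConj L) 2 (Matrix.of fun i j : Fin 2 => if i.val + j.val + 1 = 2 then (1 : L) else 0) ×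
          UnitaryGroup.arch (↥(maximalRealSubfield L)) L (IsCMField.complexConj L) 1 (Matrix.of fun i j : Fin 1 => if i.val + j.val + 1 = 1 then (1 : L) else 0)))
    [IsFiniteMeasureOnCompacts νGi] [νGi.IsMulRightInvariant] [IsFiniteMeasureOnCompacts νqi] [νqi.IsMulRightInvariant]
    [IsFiniteMeasureOnCompacts νHi] [νHi.IsMulRightInvariant]

set_option linter.unusedSectionVars false in  -- the frame's auto-included instance binders are part of the sockets' TYPES (bytes frozen); `omit` would change them
set_option maxHeartbeats 1600000 in  -- HB: two socket statements (≈ 120 lines of binders) + the ★ #7R term are elaborated and unified in one declaration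
/-- **`explicitNonsplitConstantPhase_of_germConstantStableSheets` — socket #4 `sig_K2E4ExplicitNonsplitConstantPhase` FROM SOCKET #5 `sig_K2E3GermConstantStableSheets` ALONE**
(hypothesis = #5's bytes verbatim; conclusion = #4's bytes verbatim; same frame): ★ `explicitNonsplitConstantPhase_of_germConstantsR` (#5, #7R ⇒ #4) with #7R := ★
`K2E3GermConstantRegularHR.germConstantRegularHR` BY NAME.  Print: «(a) Then `Δ_{G/H}(γ₀)Φ^κ(γ₀, f) = f^H(γ₀)`», «Assume that compatible measure on H and H′ are used.»
[cite: Rogawski1990, §8.2 Prop. 8.2.1 (a) p. 118] [cite: Rogawski1990, §8.1 Prop. 8.1.3 p. 116] [cite: Rogawski1990, §4.9 p. 55] -/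
theorem explicitNonsplitConstantPhase_of_germConstantStableSheets
    (hKer :
        ∀ (hK : ∀ v : HeightOneSpectrum (𝓞 ↥(maximalRealSubfield L)), νG v (UnitaryGroup.cmLocalIntegralLevel L 3 H' v : Set ((UnitaryGroup.cmDatum L 3 H').Local v)) = 1)
          (hanis : ∀ x : Fin 3 → L, hermForm (cmConjRingHom L) H' x x = 0 → x = 0)
          (Sbad : Finset (HeightOneSpectrum (𝓞 ↥(maximalRealSubfield L))))
              (Δ : ∀ v : HeightOneSpectrum (𝓞 ↥(maximalRealSubfield L)), LocalTransferFactor L H' v)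
              (mH : ∀ v : HeightOneSpectrum (𝓞 ↥(maximalRealSubfield L)),
                OrbitalMeasureFamily ((UnitaryGroup.cmDatum L 2 (Matrix.of fun i j : Fin 2 => if i.val + j.val + 1 = 2 then (1 : L) else 0)).Local v ×
                  (UnitaryGroup.cmDatum L 1 (Matrix.of fun i j : Fin 1 => if i.val + j.val + 1 = 1 then (1 : L) else 0)).Local v))
              (mG : ∀ v : HeightOneSpectrum (𝓞 ↥(maximalRealSubfield L)), OrbitalMeasureFamily ((UnitaryGroup.cmDatum L 3 H').Local v))
          (m' : OrbitalMeasureFamily (UnitaryGroup.arch (↥(maximalRealSubfield L)) L (IsCMField.complexConj L) 3 H'))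
                (m : OrbitalMeasureFamily (UnitaryGroup.arch (↥(maximalRealSubfield L)) L (IsCMField.complexConj L) 3
                  (Matrix.of fun i j : Fin 3 => if i.val + j.val + 1 = 3 then (1 : L) else 0)))
                (mHi : OrbitalMeasureFamily (UnitaryGroup.arch (↥(maximalRealSubfield L)) L (IsCMField.complexConj L) 2
                    (Matrix.of fun i j : Fin 2 => if i.val + j.val + 1 = 2 then (1 : L) else 0) ×
                  UnitaryGroup.arch (↥(maximalRealSubfield L)) L (IsCMField.complexConj L) 1
                    (Matrix.of fun i j : Fin 1 => if i.val + j.val + 1 = 1 then (1 : L) else 0)))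
                (t' : ∀ γ' : UnitaryGroup.arch (↥(maximalRealSubfield L)) L (IsCMField.complexConj L) 3 H',
                  Measure (Subgroup.centralizer ({γ'} : Set (UnitaryGroup.arch (↥(maximalRealSubfield L)) L (IsCMField.complexConj L) 3 H'))))
                (t : ∀ γ : UnitaryGroup.arch (↥(maximalRealSubfield L)) L (IsCMField.complexConj L) 3
                    (Matrix.of fun i j : Fin 3 => if i.val + j.val + 1 = 3 then (1 : L) else 0),
                  Measure (Subgroup.centralizer ({γ} : Set (UnitaryGroup.arch (↥(maximalRealSubfield L)) L (IsCMField.complexConj L) 3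
                    (Matrix.of fun i j : Fin 3 => if i.val + j.val + 1 = 3 then (1 : L) else 0)))))
                (tH : ∀ γH : UnitaryGroup.arch (↥(maximalRealSubfield L)) L (IsCMField.complexConj L) 2
                      (Matrix.of fun i j : Fin 2 => if i.val + j.val + 1 = 2 then (1 : L) else 0) ×
                    UnitaryGroup.arch (↥(maximalRealSubfield L)) L (IsCMField.complexConj L) 1
                      (Matrix.of fun i j : Fin 1 => if i.val + j.val + 1 = 1 then (1 : L) else 0),
                  Measure (Subgroup.centralizer ({γH} : Set (UnitaryGroup.arch (↥(maximalRealSubfield L)) L (IsCMField.complexConj L) 2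
                      (Matrix.of fun i j : Fin 2 => if i.val + j.val + 1 = 2 then (1 : L) else 0) ×
                    UnitaryGroup.arch (↥(maximalRealSubfield L)) L (IsCMField.complexConj L) 1
                      (Matrix.of fun i j : Fin 1 => if i.val + j.val + 1 = 1 then (1 : L) else 0)))))
            (hherm : (H'.map (cmConjRingHom L)).transpose = H')
            (hCTM : CanonicalTransferMatrix L H' Tinf.Δ νH νG Sbad Δ mH mG)
            (hACS : ArchCanonicalSingularMatrix L H' Tinf νGi νqi νHi hanis m' m mHi t' t tH),
    ∀ (μ : Literature.NumberTheory.GaloisRepresentations.HeckeCharacter L) (hμu : μ.IsUnitary)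
      (hμω : ∀ x : Literature.NumberTheory.GaloisRepresentations.ideleGroup ↥(maximalRealSubfield L),
        μ (AdeleRing.ideleBaseChange (↥(maximalRealSubfield L)) L x) = quadraticHeckeCharCM L x)
      (hΔ : Δ = finExplicitCollection L H' μ (finExplicitDelta_conj_left_all L H' μ) (finExplicitDelta_conj_right_all L H' μ))
      (hTinf : Tinf = archCanonicalTransferFactor L H' μ),
        ∀ (mGs₀ : ∀ v : HeightOneSpectrum (𝓞 ↥(maximalRealSubfield L)), OrbitalMeasureFamily ((UnitaryGroup.cmDatum L 3 H').Local v)),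
          (∀ v, (mGs₀ v).IsQuotientOf (fun x : (UnitaryGroup.cmDatum L 3 H').Local v => ∃ γ₀ : (UnitaryGroup.cmDatum L 3 H').Rational, ¬ IsRegularElt (γ₀.val : GL (Fin 3) L) ∧
                Corresponds (UnitaryGroup.conjLocal L (IsCMField.complexConj L) v)
                  ((UnitaryGroup.adelicForm L 3 H').map (UnitaryGroup.adeleToLocal L v))
                  ((UnitaryGroup.adelicForm L 3 H').map (UnitaryGroup.adeleToLocal L v))
                  ((UnitaryGroup.cmDatum L 3 H').toLocal v ((UnitaryGroup.cmDatum L 3 H').toAdelic γ₀)) x) (νG v) (Literature.NumberTheory.Weil1982.UnitaryFinTopForm.finTamagawaPartner L 3 H' v)) →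
              ∀ (γ₀ : (UnitaryGroup.cmDatum L 3 H').Rational) (e₁ e₂ : L), e₁ ≠ e₂ →
                ((((γ₀ : unitaryGroup (cmConjRingHom L) H').val : GL (Fin 3) L) : Matrix (Fin 3) (Fin 3) L) - e₁ • (1 : Matrix (Fin 3) (Fin 3) L)) * ((((γ₀ : unitaryGroup (cmConjRingHom L) H').val : GL (Fin 3) L) : Matrix (Fin 3) (Fin 3) L) - e₂ • (1 : Matrix (Fin 3) (Fin 3) L)) = 0 →
                (¬ ∃ ζ : L, (((γ₀ : unitaryGroup (cmConjRingHom L) H').val : GL (Fin 3) L) : Matrix (Fin 3) (Fin 3) L) = ζ • (1 : Matrix (Fin 3) (Fin 3) L)) →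
                (((γ₀ : unitaryGroup (cmConjRingHom L) H').val : GL (Fin 3) L) : Matrix (Fin 3) (Fin 3) L).charpoly =
                  (Polynomial.X - Polynomial.C e₁) ^ 2 * (Polynomial.X - Polynomial.C e₂) →
                ∀ (γH : (UnitaryGroup.cmDatum L 2 (Matrix.of fun i j : Fin 2 => if i.val + j.val + 1 = 2 then (1 : L) else 0)).Rational ×
                    (UnitaryGroup.cmDatum L 1 (Matrix.of fun i j : Fin 1 => if i.val + j.val + 1 = 1 then (1 : L) else 0)).Rational),
                  (((γH.1 : unitaryGroup (cmConjRingHom L) (Matrix.of fun i j : Fin 2 => if i.val + j.val + 1 = 2 then (1 : L) else 0)).val : GL (Fin 2) L) : Matrix (Fin 2) (Fin 2) L) =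
                    e₁ • (1 : Matrix (Fin 2) (Fin 2) L) →
                  (((γH.2 : unitaryGroup (cmConjRingHom L) (Matrix.of fun i j : Fin 1 => if i.val + j.val + 1 = 1 then (1 : L) else 0)).val : GL (Fin 1) L) : Matrix (Fin 1) (Fin 1) L) 0 0 = e₂ →
                  ∀ (v : HeightOneSpectrum (𝓞 ↥(maximalRealSubfield L)))
    (fH : (UnitaryGroup.cmDatum L 2 (Matrix.of fun i j : Fin 2 => if i.val + j.val + 1 = 2 then (1 : L) else 0)).Local v × (UnitaryGroup.cmDatum L 1 (Matrix.of fun i j : Fin 1 => if i.val + j.val + 1 = 1 then (1 : L) else 0)).Local v → ℂ) (f : (UnitaryGroup.cmDatum L 3 H').Local v → ℂ),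
                    IsLocSmooth f → IsLocSmooth fH → IsLocalDeltaTransfer L H' v (Δ v) (mH v) (mG v) fH f →
                    localStableOrbitalIntegral L 3 H' v (mGs₀ v) f ((UnitaryGroup.cmDatum L 3 H').toLocal v ((UnitaryGroup.cmDatum L 3 H').toAdelic γ₀)) = 0 →
                    fH ((UnitaryGroup.cmDatum L 2 (Matrix.of fun i j : Fin 2 => if i.val + j.val + 1 = 2 then (1 : L) else 0)).toLocal v ((UnitaryGroup.cmDatum L 2 (Matrix.of fun i j : Fin 2 => if i.val + j.val + 1 = 2 then (1 : L) else 0)).toAdelic γH.1),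
                            (UnitaryGroup.cmDatum L 1 (Matrix.of fun i j : Fin 1 => if i.val + j.val + 1 = 1 then (1 : L) else 0)).toLocal v ((UnitaryGroup.cmDatum L 1 (Matrix.of fun i j : Fin 1 => if i.val + j.val + 1 = 1 then (1 : L) else 0)).toAdelic γH.2)) = 0) :
        ∀ (hK : ∀ v : HeightOneSpectrum (𝓞 ↥(maximalRealSubfield L)), νG v (UnitaryGroup.cmLocalIntegralLevel L 3 H' v : Set ((UnitaryGroup.cmDatum L 3 H').Local v)) = 1)
          (hanis : ∀ x : Fin 3 → L, hermForm (cmConjRingHom L) H' x x = 0 → x = 0)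
          (Sbad : Finset (HeightOneSpectrum (𝓞 ↥(maximalRealSubfield L))))
              (Δ : ∀ v : HeightOneSpectrum (𝓞 ↥(maximalRealSubfield L)), LocalTransferFactor L H' v)
              (mH : ∀ v : HeightOneSpectrum (𝓞 ↥(maximalRealSubfield L)),
                OrbitalMeasureFamily ((UnitaryGroup.cmDatum L 2 (Matrix.of fun i j : Fin 2 => if i.val + j.val + 1 = 2 then (1 : L) else 0)).Local v ×
                  (UnitaryGroup.cmDatum L 1 (Matrix.of fun i j : Fin 1 => if i.val + j.val + 1 = 1 then (1 : L) else 0)).Local v))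
              (mG : ∀ v : HeightOneSpectrum (𝓞 ↥(maximalRealSubfield L)), OrbitalMeasureFamily ((UnitaryGroup.cmDatum L 3 H').Local v))
          (m' : OrbitalMeasureFamily (UnitaryGroup.arch (↥(maximalRealSubfield L)) L (IsCMField.complexConj L) 3 H'))
                (m : OrbitalMeasureFamily (UnitaryGroup.arch (↥(maximalRealSubfield L)) L (IsCMField.complexConj L) 3
                  (Matrix.of fun i j : Fin 3 => if i.val + j.val + 1 = 3 then (1 : L) else 0)))
                (mHi : OrbitalMeasureFamily (UnitaryGroup.arch (↥(maximalRealSubfield L)) L (IsCMField.complexConj L) 2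
                    (Matrix.of fun i j : Fin 2 => if i.val + j.val + 1 = 2 then (1 : L) else 0) ×
                  UnitaryGroup.arch (↥(maximalRealSubfield L)) L (IsCMField.complexConj L) 1
                    (Matrix.of fun i j : Fin 1 => if i.val + j.val + 1 = 1 then (1 : L) else 0)))
                (t' : ∀ γ' : UnitaryGroup.arch (↥(maximalRealSubfield L)) L (IsCMField.complexConj L) 3 H',
                  Measure (Subgroup.centralizer ({γ'} : Set (UnitaryGroup.arch (↥(maximalRealSubfield L)) L (IsCMField.complexConj L) 3 H'))))
                (t : ∀ γ : UnitaryGroup.arch (↥(maximalRealSubfield L)) L (IsCMField.complexConj L) 3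
                    (Matrix.of fun i j : Fin 3 => if i.val + j.val + 1 = 3 then (1 : L) else 0),
                  Measure (Subgroup.centralizer ({γ} : Set (UnitaryGroup.arch (↥(maximalRealSubfield L)) L (IsCMField.complexConj L) 3
                    (Matrix.of fun i j : Fin 3 => if i.val + j.val + 1 = 3 then (1 : L) else 0)))))
                (tH : ∀ γH : UnitaryGroup.arch (↥(maximalRealSubfield L)) L (IsCMField.complexConj L) 2
                      (Matrix.of fun i j : Fin 2 => if i.val + j.val + 1 = 2 then (1 : L) else 0) ×
                    UnitaryGroup.arch (↥(maximalRealSubfield L)) L (IsCMField.complexConj L) 1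
                      (Matrix.of fun i j : Fin 1 => if i.val + j.val + 1 = 1 then (1 : L) else 0),
                  Measure (Subgroup.centralizer ({γH} : Set (UnitaryGroup.arch (↥(maximalRealSubfield L)) L (IsCMField.complexConj L) 2
                      (Matrix.of fun i j : Fin 2 => if i.val + j.val + 1 = 2 then (1 : L) else 0) ×
                    UnitaryGroup.arch (↥(maximalRealSubfield L)) L (IsCMField.complexConj L) 1
                      (Matrix.of fun i j : Fin 1 => if i.val + j.val + 1 = 1 then (1 : L) else 0)))))
            (hherm : (H'.map (cmConjRingHom L)).transpose = H')
            (hCTM : CanonicalTransferMatrix L H' Tinf.Δ νH νG Sbad Δ mH mG)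
            (hACS : ArchCanonicalSingularMatrix L H' Tinf νGi νqi νHi hanis m' m mHi t' t tH),
    ∀ (μ : Literature.NumberTheory.GaloisRepresentations.HeckeCharacter L) (hμu : μ.IsUnitary)
      (hμω : ∀ x : Literature.NumberTheory.GaloisRepresentations.ideleGroup ↥(maximalRealSubfield L),
        μ (AdeleRing.ideleBaseChange (↥(maximalRealSubfield L)) L x) = quadraticHeckeCharCM L x)
      (hΔ : Δ = finExplicitCollection L H' μ (finExplicitDelta_conj_left_all L H' μ) (finExplicitDelta_conj_right_all L H' μ))
      (hTinf : Tinf = archCanonicalTransferFactor L H' μ),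
        ∀ (mGs₀ : ∀ v : HeightOneSpectrum (𝓞 ↥(maximalRealSubfield L)), OrbitalMeasureFamily ((UnitaryGroup.cmDatum L 3 H').Local v)),
          (∀ v, (mGs₀ v).IsQuotientOf (fun x : (UnitaryGroup.cmDatum L 3 H').Local v => ∃ γ₀ : (UnitaryGroup.cmDatum L 3 H').Rational, ¬ IsRegularElt (γ₀.val : GL (Fin 3) L) ∧
                Corresponds (UnitaryGroup.conjLocal L (IsCMField.complexConj L) v)
                  ((UnitaryGroup.adelicForm L 3 H').map (UnitaryGroup.adeleToLocal L v))
                  ((UnitaryGroup.adelicForm L 3 H').map (UnitaryGroup.adeleToLocal L v))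
                  ((UnitaryGroup.cmDatum L 3 H').toLocal v ((UnitaryGroup.cmDatum L 3 H').toAdelic γ₀)) x) (νG v) (Literature.NumberTheory.Weil1982.UnitaryFinTopForm.finTamagawaPartner L 3 H' v)) →
              ∀ (γ₀ : (UnitaryGroup.cmDatum L 3 H').Rational) (e₁ e₂ : L), e₁ ≠ e₂ →
                ((((γ₀ : unitaryGroup (cmConjRingHom L) H').val : GL (Fin 3) L) : Matrix (Fin 3) (Fin 3) L) - e₁ • (1 : Matrix (Fin 3) (Fin 3) L)) * ((((γ₀ : unitaryGroup (cmConjRingHom L) H').val : GL (Fin 3) L) : Matrix (Fin 3) (Fin 3) L) - e₂ • (1 : Matrix (Fin 3) (Fin 3) L)) = 0 →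
                (¬ ∃ ζ : L, (((γ₀ : unitaryGroup (cmConjRingHom L) H').val : GL (Fin 3) L) : Matrix (Fin 3) (Fin 3) L) = ζ • (1 : Matrix (Fin 3) (Fin 3) L)) →
                (((γ₀ : unitaryGroup (cmConjRingHom L) H').val : GL (Fin 3) L) : Matrix (Fin 3) (Fin 3) L).charpoly =
                  (Polynomial.X - Polynomial.C e₁) ^ 2 * (Polynomial.X - Polynomial.C e₂) →
                ∀ (γH : (UnitaryGroup.cmDatum L 2 (Matrix.of fun i j : Fin 2 => if i.val + j.val + 1 = 2 then (1 : L) else 0)).Rational ×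
                    (UnitaryGroup.cmDatum L 1 (Matrix.of fun i j : Fin 1 => if i.val + j.val + 1 = 1 then (1 : L) else 0)).Rational),
                  (((γH.1 : unitaryGroup (cmConjRingHom L) (Matrix.of fun i j : Fin 2 => if i.val + j.val + 1 = 2 then (1 : L) else 0)).val : GL (Fin 2) L) : Matrix (Fin 2) (Fin 2) L) =
                    e₁ • (1 : Matrix (Fin 2) (Fin 2) L) →
                  (((γH.2 : unitaryGroup (cmConjRingHom L) (Matrix.of fun i j : Fin 1 => if i.val + j.val + 1 = 1 then (1 : L) else 0)).val : GL (Fin 1) L) : Matrix (Fin 1) (Fin 1) L) 0 0 = e₂ →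
                  ∀ (v : HeightOneSpectrum (𝓞 ↥(maximalRealSubfield L))), Subsingleton (UnitaryGroup.PlacesOver L v) →
                    ∃ cv : ℂ, (∃ r : ℝ, r ≠ 0 ∧ cv * (Δ v).Δ ((UnitaryGroup.cmDatum L 2 (Matrix.of fun i j : Fin 2 => if i.val + j.val + 1 = 2 then (1 : L) else 0)).toLocal v ((UnitaryGroup.cmDatum L 2 (Matrix.of fun i j : Fin 2 => if i.val + j.val + 1 = 2 then (1 : L) else 0)).toAdelic γH.1),
                            (UnitaryGroup.cmDatum L 1 (Matrix.of fun i j : Fin 1 => if i.val + j.val + 1 = 1 then (1 : L) else 0)).toLocal v ((UnitaryGroup.cmDatum L 1 (Matrix.of fun i j : Fin 1 => if i.val + j.val + 1 = 1 then (1 : L) else 0)).toAdelic γH.2)) ((UnitaryGroup.cmDatum L 3 H').toLocal v ((UnitaryGroup.cmDatum L 3 H').toAdelic γ₀)) = (r : ℂ)) ∧ ∀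
                          (fH : (UnitaryGroup.cmDatum L 2 (Matrix.of fun i j : Fin 2 => if i.val + j.val + 1 = 2 then (1 : L) else 0)).Local v × (UnitaryGroup.cmDatum L 1 (Matrix.of fun i j : Fin 1 => if i.val + j.val + 1 = 1 then (1 : L) else 0)).Local v → ℂ) (f : (UnitaryGroup.cmDatum L 3 H').Local v → ℂ),
                        IsLocSmooth f → IsLocSmooth fH → IsLocalDeltaTransfer L H' v (Δ v) (mH v) (mG v) fH f →
                        localStableOrbitalIntegral L 3 H' v (mGs₀ v) f ((UnitaryGroup.cmDatum L 3 H').toLocal v ((UnitaryGroup.cmDatum L 3 H').toAdelic γ₀)) =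
                          cv * fH ((UnitaryGroup.cmDatum L 2 (Matrix.of fun i j : Fin 2 => if i.val + j.val + 1 = 2 then (1 : L) else 0)).toLocal v ((UnitaryGroup.cmDatum L 2 (Matrix.of fun i j : Fin 2 => if i.val + j.val + 1 = 2 then (1 : L) else 0)).toAdelic γH.1),
                            (UnitaryGroup.cmDatum L 1 (Matrix.of fun i j : Fin 1 => if i.val + j.val + 1 = 1 then (1 : L) else 0)).toLocal v ((UnitaryGroup.cmDatum L 1 (Matrix.of fun i j : Fin 1 => if i.val + j.val + 1 = 1 then (1 : L) else 0)).toAdelic γH.2)) :=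
  K2E4ExplicitNonsplitConstantPhaseOfGermSocketsR.explicitNonsplitConstantPhase_of_germConstantsR L H' Tinf νH νG νGi νqi νHi hKer
    (K2E3GermConstantRegularHR.germConstantRegularHR L H' Tinf νH νG νGi νqi νHi)  -- ★ #7R BY NAME (K2E4-p07)

end Frame

end Summit.HodgeConjecture.HodgeConjecture.Cruxes.H413.K2E4ExplicitNonsplitConstantPhaseOfStableSheets

end
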